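import Summits.CriticalPhenomena.PercolationContinuityZ3.Theorems.PercNearOneGluingNoHeavyLowerTailStarSetPool
import Summits.CriticalPhenomena.PercolationContinuityZ3.Theorems.PercNearOneGluingNoHeavyLowerTailStarSetOmegaCliques
import HarnessLib

/-!
# `NoHeavyLowerTail` (stmt-CriticalPhenomena-4575) — the pool of the residual bound, instantiated (U1-PROOF.md §7; blueprint §G4)

Support file (prover `prim-gen-swap` gen 15; `--supports stmt-CriticalPhenomena-4575`).  No definitions, no named facts, no sorries.

`StarSet.residual_pool_inst` feeds the CORE units of the residual bound (group units of type H / cold `I₀`-units / bundle units, all riders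
through `r`) into the abstract pool `StarSet.pool_bound`: it defines the partner groups, hubs, triangle matching, dominators, flags and the
pool WORDS as explicit `O`-products — SELF `(X→e, J→s, dom X ē→ē)`, SELF′ `(X→ē, J→s, I₀→q₀)`, CROSS `(X→e, Y→ē_Y, J→s_X)`, SELF_I
`(X→a, I₀→q₀, dom X a→u)`, CROSS_I `(X→a_X, Y→a_Y, I₀→q₀)` (`q₀ = P I₀`; port selectors `e(J,X)` = port of `X` in `J`, `ē(J,X)` the other,
`s(J,X)` = port of `J` other than `e`, `a(X)` = port of `X` other than `q₀`, `u(X)` = port of `dom X a` other than `a`) — and checks the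
hypotheses of `pool_bound`.  `I₀` is the leaf class at `r` when there is one, else any class outside the pool and the partners.
-/

namespace Summit.CriticalPhenomena.PercolationContinuityZ3.Theorems

open Finset
open scoped BigOperators Classical

namespace StarSet

variable {ι V : Type*} [Fintype ι] [LinearOrder ι] [DecidableEq V]

/-- **The pool of the residual bound, instantiated.**  See the file header. -/
theorem residual_pool_inst (P P' : ι → V) (hPP' : ∀ X, P X ≠ P' X)
    (hinj : Function.Injective fun X => (s(P X, P' X) : Sym2 V)) (r : V) (F : Finset ι)
    (θ : ι → ℝ) (hθ0 : ∀ X, 0 ≤ θ X) (hθ1 : ∀ X, θ X < 1) (O : ι → V → ℝ)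
    (hO1 : ∀ X d, (P X = d ∨ P' X = d) → θ X ≤ (1 - θ X) * O X d)
    (dom : ι → V → ι)
    (hdom : ∀ X ∉ F, ∀ d, (P X = d ∨ P' X = d) →
      dom X d ∈ F ∧ (P (dom X d) = d ∨ P' (dom X d) = d) ∧
        (∀ u, (P (dom X d) = u ∨ P' (dom X d) = u) → (P X = u ∨ P' X = u) → u = d) ∧ θ X ≤ θ (dom X d))
    (I₀ : ι) (hI₀pool : ¬ ((I₀ ∉ F ∧ (P I₀ = r ∨ P' I₀ = r)) ∨ (I₀ ∈ F ∧ P I₀ = r)))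
    (hleaf : ∀ I ∈ F, P' I = r → I = I₀)
    (Ug Uc Uh : Finset (Finset ι × ι)) (Jf : Finset ι × ι → ι) (ef ēf : Finset ι × ι → V)
    (hUg : ∀ u ∈ Ug, u.2 ∈ u.1 ∧ u.2 ∉ F ∧ (P u.2 ≠ r ∧ P' u.2 ≠ r) ∧ Jf u ∈ u.1 ∧ Jf u ∈ F ∧
      (P (Jf u) ≠ r ∧ P' (Jf u) ≠ r) ∧ Jf u ≠ I₀ ∧
      ((P u.2 = ef u ∧ P' u.2 = ēf u) ∨ (P u.2 = ēf u ∧ P' u.2 = ef u)) ∧ (P (Jf u) = ef u ∨ P' (Jf u) = ef u) ∧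
      ¬ (P (Jf u) = ēf u ∨ P' (Jf u) = ēf u) ∧ (P (dom u.2 (ēf u)) = r ∨ P' (dom u.2 (ēf u)) = r) ∧
      ¬ (P' (dom u.2 (ēf u)) = r ∧ Jf u = dom u.2 (ef u)) ∧
      (∀ K ∈ u.1, K ≠ u.2 → K ≠ Jf u → (P K = r ∨ P' K = r)) ∧
      (∀ Y ∈ u.1, P Y = P u.2 ∨ P Y = P' u.2 ∨ P' Y = P u.2 ∨ P' Y = P' u.2))
    (hUc : ∀ u ∈ Uc, u.2 ∈ u.1 ∧ u.2 ∉ F ∧ (P u.2 ≠ r ∧ P' u.2 ≠ r) ∧ (P u.2 = P I₀ ∨ P' u.2 = P I₀) ∧ I₀ ∈ u.1 ∧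
      I₀ ∈ F ∧ P' I₀ = r ∧ dom u.2 (P I₀) ≠ I₀ ∧
      (P (dom u.2 (if P u.2 = P I₀ then P' u.2 else P u.2)) ≠ r ∧ P' (dom u.2 (if P u.2 = P I₀ then P' u.2 else P u.2)) ≠ r) ∧
      (∀ K ∈ u.1, K ≠ u.2 → K ≠ I₀ → (P K = r ∨ P' K = r)))
    (hUh : ∀ u ∈ Uh, u.2 ∈ u.1 ∧ u.2 ∉ F ∧ (P u.2 ≠ r ∧ P' u.2 ≠ r) ∧ (P u.2 = P I₀ ∨ P' u.2 = P I₀) ∧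
      I₀ ∈ F ∧ P' I₀ = r ∧ dom u.2 (P I₀) = I₀ ∧
      (P (dom u.2 (if P u.2 = P I₀ then P' u.2 else P u.2)) ≠ r ∧ P' (dom u.2 (if P u.2 = P I₀ then P' u.2 else P u.2)) ≠ r) ∧
      (I₀ ∈ u.1 ∨ dom u.2 (if P u.2 = P I₀ then P' u.2 else P u.2) ∈ u.1) ∧
      (∀ K ∈ u.1, K ≠ u.2 → K ≠ I₀ → K ≠ dom u.2 (if P u.2 = P I₀ then P' u.2 else P u.2) → (P K = r ∨ P' K = r))) :
    ∑ u ∈ Ug, ((∏ k ∈ u.1, θ k) * ∏ k ∈ univ \ u.1, (1 - θ k)) + ∑ u ∈ Uc, ((∏ k ∈ u.1, θ k)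
          * ∏ k ∈ univ \ u.1, (1 - θ k)) + ∑ u ∈ Uh, ((∏ k ∈ u.1, θ k) * ∏ k ∈ univ \ u.1, (1 - θ k)) ≤
      ∏ k ∈ univ \ (univ : Finset ι).filter (fun K => (K ∉ F ∧ (P K = r ∨ P' K = r)) ∨ (K ∈ F ∧ P K = r)), (1 - θ k) +
        (∑ J ∈ Ug.image Jf, ∑ X ∈ (Ug.filter (fun u => Jf u = J)).image Prod.snd,
            (O X (if (P X = P J ∨ P X = P' J) then P X else P' X) * O J (if P J = (if (P X = P J ∨ P X = P' J) then P X else P' X) then P' J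
                  else P J) * O (dom X (if (P X = P J ∨ P X = P' J) then P' X else P X)) (if (P X = P J ∨ P X = P' J) then P' X else P X) +
            (if (((P X = P I₀ ∨ P' X = P I₀) ∧ I₀ ∈ F ∧ P' I₀ = r) ∧ dom X (if (P X = P J ∨ P X = P' J) then P' X else P X) ≠ I₀)
                  then O X (if (P X = P J ∨ P X = P' J) then P' X else P X) * O J (if P J = (if (P X = P J ∨ P X = P' J) then P X else P' X)
                  then P' J else P J) * O I₀ (P I₀) else 0)) +
          ∑ J ∈ Ug.image Jf, ∑ X ∈ (Ug.filter (fun u => Jf u = J)).image Prod.snd,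
            ∑ Y ∈ ((Ug.filter (fun u => Jf u = J)).image Prod.snd).filter (fun Y => Y ≠ X ∧ ¬ (X ≠ Y ∧ (if (P X = P J ∨ P X = P' J) then P' X
                  else P X) = (if (P Y = P J ∨ P Y = P' J) then P' Y else P Y))),
              (O X (if (P X = P J ∨ P X = P' J) then P X else P' X) * O Y (if (P Y = P J ∨ P Y = P' J) then P' Y else P Y)
                    * O J (if P J = (if (P X = P J ∨ P X = P' J) then P X else P' X) then P' J else P J)) +
          ∑ X ∈ Uc.image Prod.snd ∪ Uh.image Prod.snd, (O X (if P X = P I₀ then P' X else P X) * O I₀ (P I₀) * O (dom X (if P X = P I₀ then P' X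
                else P X)) (if P (dom X (if P X = P I₀ then P' X else P X)) = (if P X = P I₀ then P' X else P X) then P' (dom X (if P X = P I₀
                then P' X else P X)) else P (dom X (if P X = P I₀ then P' X else P X)))) +
          ∑ X ∈ Uc.image Prod.snd ∪ Uh.image Prod.snd, ∑ Y ∈ (Uc.image Prod.snd ∪ Uh.image Prod.snd).filter (fun Y => X < Y),
            (O X (if P X = P I₀ then P' X else P X) * O Y (if P Y = P I₀ then P' Y else P Y) * O I₀ (P I₀))) := by
  set pool : ι → Prop := (fun K => (K ∉ F ∧ (P K = r ∨ P' K = r)) ∨ (K ∈ F ∧ P K = r)) with hpool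
  set Pool : Finset ι := (univ : Finset ι).filter pool with hPool
  set eJ : ι → ι → V := fun J X => (if (P X = P J ∨ P X = P' J) then P X else P' X) with heJ
  set ēJ : ι → ι → V := fun J X => (if (P X = P J ∨ P X = P' J) then P' X else P X) with hēJ
  set sJ : ι → ι → V := fun J X => (if P J = (if (P X = P J ∨ P X = P' J) then P X else P' X) then P' J else P J) with hsJ
  set aI : ι → V := fun X => (if P X = P I₀ then P' X else P X) with haI
  set Dh : ι → ι := fun X => dom X (if P X = P I₀ then P' X else P X) with hDh
  set uI : ι → V := fun X => (if P (dom X (if P X = P I₀ then P' X else P X)) = (if P X = P I₀ then P' X else P X) then P' (dom X (if P X = P I₀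
        then P' X else P X)) else P (dom X (if P X = P I₀ then P' X else P X))) with huI
  set Dg : ι → ι → ι := fun J X => dom X (if (P X = P J ∨ P X = P' J) then P' X else P X) with hDg
  set wself : ι → ι → ℝ := fun J X => (O X (if (P X = P J ∨ P X = P' J) then P X else P' X) * O J (if P J = (if (P X = P J ∨ P X = P' J)
        then P X else P' X) then P' J else P J) * O (dom X (if (P X = P J ∨ P X = P' J) then P' X else P X)) (if (P X = P J ∨ P X = P' J) then P' X else P X) +
            (if (((P X = P I₀ ∨ P' X = P I₀) ∧ I₀ ∈ F ∧ P' I₀ = r) ∧ dom X (if (P X = P J ∨ P X = P' J) then P' X else P X) ≠ I₀)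
                  then O X (if (P X = P J ∨ P X = P' J) then P' X else P X) * O J (if P J = (if (P X = P J ∨ P X = P' J) then P X else P' X)
                  then P' J else P J) * O I₀ (P I₀) else 0)) with hwself
  set wcross : ι → ι → ι → ℝ := fun J X Y => (O X (if (P X = P J ∨ P X = P' J) then P X else P' X) * O Y (if (P Y = P J ∨ P Y = P' J) then P' Y
        else P Y) * O J (if P J = (if (P X = P J ∨ P X = P' J) then P X else P' X) then P' J else P J)) with hwcross
  set wselfI : ι → ℝ := fun X => (O X (if P X = P I₀ then P' X else P X) * O I₀ (P I₀) * O (dom X (if P X = P I₀ then P' X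
        else P X)) (if P (dom X (if P X = P I₀ then P' X else P X)) = (if P X = P I₀ then P' X else P X) then P' (dom X (if P X = P I₀ then P' X
        else P X)) else P (dom X (if P X = P I₀ then P' X else P X)))) with hwselfI
  set wcrossI : ι → ι → ℝ := fun X Y => (O X (if P X = P I₀ then P' X else P X) * O Y (if P Y = P I₀ then P' Y else P Y) * O I₀ (P I₀)) with hwcrossI
  set Js : Finset ι := Ug.image Jf with hJs
  set 𝒳 : ι → Finset ι := fun J => (Ug.filter (fun u => Jf u = J)).image Prod.snd with h𝒳
  set Hc : Finset ι := Uc.image Prod.snd with hHc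
  set Hh : Finset ι := Uh.image Prod.snd with hHh
  have ht0 : ∀ K, 0 ≤ θ K / (1 - θ K) := fun K => div_nonneg (hθ0 K) (by linarith [hθ1 K])
  have hOt : ∀ K d, (P K = d ∨ P' K = d) → θ K / (1 - θ K) ≤ O K d := fun K d hd => by
    rw [div_le_iff₀ (by linarith [hθ1 K])]; linarith [hO1 K d hd]
  have htmono : ∀ K K', θ K ≤ θ K' → θ K / (1 - θ K) ≤ θ K' / (1 - θ K') := by
    intro K K' h
    rw [div_le_div_iff₀ (by linarith [hθ1 K]) (by linarith [hθ1 K'])]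
    nlinarith [hθ0 K, hθ1 K']
  have h3le : ∀ a b c x y z : ℝ, 0 ≤ a → 0 ≤ b → 0 ≤ c → a ≤ x → b ≤ y → c ≤ z → a * b * c ≤ x * y * z :=
    fun a b c x y z ha hb hc hx hy hz => mul_le_mul (mul_le_mul hx hy hb (ha.trans hx)) hz hc (mul_nonneg (ha.trans hx) (hb.trans hy))
  have hpool_of_r : ∀ K, K ≠ I₀ → (P K = r ∨ P' K = r) → K ∈ Pool := by
    intro K hKI hKr
    rw [hPool, mem_filter]
    refine ⟨mem_univ _, ?_⟩
    by_cases hKF : K ∈ F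
    · rcases hKr with h | h; exacts [Or.inr ⟨hKF, h⟩, absurd (hleaf K hKF h) hKI]
    · exact Or.inl ⟨hKF, hKr⟩
  have hnotpool : ∀ K, (P K ≠ r ∧ P' K ≠ r) → K ∉ Pool := by
    intro K hK hKP
    rw [hPool, mem_filter] at hKP
    rcases hKP.2 with ⟨-, h | h⟩ | ⟨-, h⟩
    · exact hK.1 h
    · exact hK.2 h
    · exact hK.1 h
  have hI₀P : I₀ ∉ Pool := fun h => hI₀pool (by rw [hPool, mem_filter] at h; exact h.2)
  have hhub : ∀ J ∈ Js, ∀ X ∈ 𝒳 J, ∃ u ∈ Ug, Jf u = J ∧ u.2 = X := by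
    intro J hJ X hX
    obtain ⟨u, hu, rfl⟩ := mem_image.1 hX
    obtain ⟨huU, huJ⟩ := mem_filter.1 hu
    exact ⟨u, huU, huJ, rfl⟩
  have hsel : ∀ u ∈ Ug, eJ (Jf u) u.2 = ef u ∧ ēJ (Jf u) u.2 = ēf u := by
    intro u hu
    obtain ⟨-, -, -, -, -, -, -, hX, hJe, hJē, -⟩ := hUg u hu
    simp only [heJ, hēJ]
    rcases hX with ⟨h1, h2⟩ | ⟨h1, h2⟩
    · have hc : P u.2 = P (Jf u) ∨ P u.2 = P' (Jf u) := by
        rw [h1]; rcases hJe with h | h; exacts [Or.inl h.symm, Or.inr h.symm]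
      rw [if_pos hc, if_pos hc]; exact ⟨h1, h2⟩
    · have hc : ¬ (P u.2 = P (Jf u) ∨ P u.2 = P' (Jf u)) := by
        rw [h1]; rintro (h | h); exacts [hJē (Or.inl h.symm), hJē (Or.inr h.symm)]
      rw [if_neg hc, if_neg hc]; exact ⟨h2, h1⟩
  have hsJ_spec : ∀ u ∈ Ug, (P (Jf u) = sJ (Jf u) u.2 ∨ P' (Jf u) = sJ (Jf u) u.2) ∧ sJ (Jf u) u.2 ≠ ef u := by
    intro u hu
    obtain ⟨-, -, -, -, -, -, -, -, hJe, -, -⟩ := hUg u hu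
    have he := (hsel u hu).1
    simp only [hsJ]
    rw [show (if (P u.2 = P (Jf u) ∨ P u.2 = P' (Jf u)) then P u.2 else P' u.2) = eJ (Jf u) u.2 from rfl, he]
    by_cases h : P (Jf u) = ef u
    · rw [if_pos h]; exact ⟨Or.inr rfl, fun h' => hPP' (Jf u) (h.trans h'.symm)⟩
    · rw [if_neg h]; exact ⟨Or.inl rfl, h⟩
  have hXfacts : ∀ J ∈ Js, ∀ X ∈ 𝒳 J, X ∉ F ∧ (P X ≠ r ∧ P' X ≠ r) ∧ J ∈ F ∧ (P J ≠ r ∧ P' J ≠ r) ∧ J ≠ I₀ ∧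
      ((P X = eJ J X ∧ P' X = ēJ J X) ∨ (P X = ēJ J X ∧ P' X = eJ J X)) ∧ (P J = eJ J X ∨ P' J = eJ J X) ∧
      ¬ (P J = ēJ J X ∨ P' J = ēJ J X) ∧ (P J = sJ J X ∨ P' J = sJ J X) ∧ sJ J X ≠ eJ J X ∧
      (P (dom X (ēJ J X)) = r ∨ P' (dom X (ēJ J X)) = r) := by
    intro J hJ X hX
    obtain ⟨u, hu, rfl, rfl⟩ := hhub J hJ X hX
    obtain ⟨-, hXF, hXr, -, hJF, hJr, hJI, hX, hJe, hJē, hhot, -⟩ := hUg u hu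
    obtain ⟨he, hē⟩ := hsel u hu
    obtain ⟨hs, hse⟩ := hsJ_spec u hu
    rw [← he] at hX hJe hse; rw [← hē] at hX hJē hhot
    exact ⟨hXF, hXr, hJF, hJr, hJI, hX, hJe, hJē, hs, hse, hhot⟩
  have hIhub : ∀ X ∈ Hc ∪ Hh, X ∉ F ∧ (P X ≠ r ∧ P' X ≠ r) ∧ (P X = P I₀ ∨ P' X = P I₀) ∧ I₀ ∈ F ∧ P' I₀ = r ∧
      (P (Dh X) ≠ r ∧ P' (Dh X) ≠ r) := by
    intro X hX
    rcases mem_union.1 hX with hX | hX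
    · obtain ⟨u, hu, rfl⟩ := mem_image.1 hX
      obtain ⟨-, hXF, hXr, hXq, -, hIF, hIr, -, hD, -⟩ := hUc u hu
      exact ⟨hXF, hXr, hXq, hIF, hIr, hD⟩
    · obtain ⟨u, hu, rfl⟩ := mem_image.1 hX
      obtain ⟨-, hXF, hXr, hXq, hIF, hIr, -, hD, -⟩ := hUh u hu
      exact ⟨hXF, hXr, hXq, hIF, hIr, hD⟩
  have haI_spec : ∀ X, (P X = P I₀ ∨ P' X = P I₀) → (P X = aI X ∨ P' X = aI X) ∧ aI X ≠ P I₀ ∧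
      ((P X = P I₀ ∧ P' X = aI X) ∨ (P X = aI X ∧ P' X = P I₀)) := by
    intro X hXq
    simp only [haI]
    by_cases h : P X = P I₀
    · rw [if_pos h]; exact ⟨Or.inr rfl, fun h' => hPP' X (h.trans h'.symm), Or.inl ⟨h, rfl⟩⟩
    · rw [if_neg h]; exact ⟨Or.inl rfl, h, Or.inr ⟨rfl, hXq.resolve_left h⟩⟩
  have huI_spec : ∀ X, X ∉ F → (P X = P I₀ ∨ P' X = P I₀) →
      Dh X ∈ F ∧ (P (Dh X) = aI X ∨ P' (Dh X) = aI X) ∧ (P (Dh X) = uI X ∨ P' (Dh X) = uI X) ∧ uI X ≠ aI X ∧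
      ¬ (P X = uI X ∨ P' X = uI X) ∧ θ X ≤ θ (Dh X) := by
    intro X hXF hXq
    obtain ⟨haX, haq, -⟩ := haI_spec X hXq
    obtain ⟨hDF, hDa, hDother, hθD⟩ := hdom X hXF (aI X) haX
    have hDh' : Dh X = dom X (aI X) := rfl
    rw [hDh']
    have hu : (P (dom X (aI X)) = uI X ∨ P' (dom X (aI X)) = uI X) ∧ uI X ≠ aI X := by
      simp only [huI]
      by_cases h : P (dom X (aI X)) = aI X
      · rw [if_pos h]; exact ⟨Or.inr rfl, fun h' => hPP' _ (h.trans h'.symm)⟩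
      · rw [if_neg h]; exact ⟨Or.inl rfl, h⟩
    refine ⟨hDF, hDa, hu.1, hu.2, fun hXu => hu.2 (hDother (uI X) hu.1 hXu), hθD⟩
  have hJs' : ∀ J ∈ Js, J ∉ Pool ∧ J ≠ I₀ := by
    intro J hJ
    obtain ⟨u, hu, rfl⟩ := mem_image.1 hJ
    obtain ⟨-, -, -, -, -, hJr, hJI, -⟩ := hUg u hu
    exact ⟨hnotpool _ hJr, hJI⟩
  have h𝒳' : ∀ J ∈ Js, ∀ X ∈ 𝒳 J, X ∉ Pool ∧ X ≠ J ∧ ((fun J X => ((P X = P I₀ ∨ P' X = P I₀) ∧ I₀ ∈ F ∧ P' I₀ = r)) J X → X ≠ I₀) := by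
    intro J hJ X hX
    obtain ⟨hXF, hXr, hJF, -, -, -⟩ := hXfacts J hJ X hX
    exact ⟨hnotpool _ hXr, fun h => hXF (h ▸ hJF), fun h h' => hXF (h' ▸ h.2.1)⟩
  have hMsymm' : ∀ J ∈ Js, ∀ X ∈ 𝒳 J, ∀ Y ∈ 𝒳 J, (fun J X Y => (X ≠ Y ∧ (if (P X = P J ∨ P X = P' J) then P' X
        else P X) = (if (P Y = P J ∨ P Y = P' J) then P' Y else P Y))) J X Y → (fun J X Y => (X ≠ Y ∧ (if (P X = P J ∨ P X = P' J) then P' X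
        else P X) = (if (P Y = P J ∨ P Y = P' J) then P' Y else P Y))) J Y X :=
    fun J _ X _ Y _ h => ⟨Ne.symm h.1, h.2.symm⟩
  have hMuniq' : ∀ J ∈ Js, ∀ X ∈ 𝒳 J, ((𝒳 J).filter (fun Y => Y ≠ X ∧ (fun J X Y => (X ≠ Y ∧ (if (P X = P J ∨ P X = P' J) then P' X
        else P X) = (if (P Y = P J ∨ P Y = P' J) then P' Y else P Y))) J X Y)).card ≤ 1 := by
    intro J hJ X hX
    obtain ⟨-, -, -, -, -, hXp, heX, hēX, -, -, -⟩ := hXfacts J hJ X hX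
    -- a hub `Y ≠ X` with the same far port is attached at the other end of `J`
    have hother : ∀ Y ∈ 𝒳 J, Y ≠ X → ēJ J Y = ēJ J X →
        ¬ (eJ J Y = eJ J X) ∧ (P J = eJ J Y ∨ P' J = eJ J Y) ∧
        ((P Y = eJ J Y ∧ P' Y = ēJ J X) ∨ (P Y = ēJ J X ∧ P' Y = eJ J Y)) := by
      intro Y hY hYX hē
      obtain ⟨-, -, -, -, -, hYp, heY, -, -, -, -⟩ := hXfacts J hJ Y hY
      refine ⟨fun he => hYX (hinj ?_), heY, by rw [← hē]; exact hYp⟩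
      simp only
      rcases hYp with ⟨h1, h2⟩ | ⟨h1, h2⟩ <;> rcases hXp with ⟨h3, h4⟩ | ⟨h3, h4⟩
      · rw [h1, h2, h3, h4, he, hē]
      · rw [h1, h2, h3, h4, he, hē]; exact Sym2.eq_swap
      · rw [h1, h2, h3, h4, he, hē]; exact Sym2.eq_swap
      · rw [h1, h2, h3, h4, he, hē]
    refine card_le_one.2 fun Y hY Y' hY' => ?_
    obtain ⟨hY𝒳, hYX, -, hYē⟩ := mem_filter.1 hY
    obtain ⟨hY'𝒳, hY'X, -, hY'ē⟩ := mem_filter.1 hY'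
    obtain ⟨hne, heY, hYp⟩ := hother Y hY𝒳 hYX hYē.symm
    obtain ⟨hne', heY', hY'p⟩ := hother Y' hY'𝒳 hY'X hY'ē.symm
    -- both are attached at the end of `J` other than `e(J,X)`
    have hee : eJ J Y = eJ J Y' := by
      rcases heY with h1 | h1 <;> rcases heY' with h2 | h2 <;> rcases heX with h3 | h3
      · exact h1.symm.trans h2
      · exact h1.symm.trans h2
      · exact absurd (h1.symm.trans h3) hne
      · exact absurd (h2.symm.trans h3) hne'
      · exact absurd (h2.symm.trans h3) hne'
      · exact absurd (h1.symm.trans h3) hne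
      · exact h1.symm.trans h2
      · exact h1.symm.trans h2
    apply hinj; simp only
    rcases hYp with ⟨h1, h2⟩ | ⟨h1, h2⟩ <;> rcases hY'p with ⟨h3, h4⟩ | ⟨h3, h4⟩
    · rw [h1, h2, h3, h4, hee]
    · rw [h1, h2, h3, h4, hee]; exact Sym2.eq_swap
    · rw [h1, h2, h3, h4, hee]; exact Sym2.eq_swap
    · rw [h1, h2, h3, h4, hee]
  have hDg' : ∀ J ∈ Js, ∀ X ∈ 𝒳 J, θ X ≤ θ (Dg J X) := by
    intro J hJ X hX
    obtain ⟨hXF, -, -, -, -, hXp, -⟩ := hXfacts J hJ X hX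
    have hēX : P X = ēJ J X ∨ P' X = ēJ J X := by rcases hXp with ⟨_, h⟩ | ⟨h, _⟩; exacts [Or.inr h, Or.inl h]
    exact (hdom X hXF _ hēX).2.2.2
  have hwself' : ∀ J ∈ Js, ∀ X ∈ 𝒳 J,
      θ X / (1 - θ X) * (θ J / (1 - θ J)) * (θ (Dg J X) / (1 - θ (Dg J X))) +
        (if (fun J X => ((P X = P I₀ ∨ P' X = P I₀) ∧ I₀ ∈ F ∧ P' I₀ = r)) J X ∧ Dg J X ≠ I₀ then θ X / (1 - θ X) * (θ J / (1 - θ J))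
              * (θ I₀ / (1 - θ I₀)) else 0) ≤ wself J X := by
    intro J hJ X hX
    obtain ⟨hXF, -, -, -, -, hXp, -, -, hJs, -, hhot⟩ := hXfacts J hJ X hX
    have heX : P X = eJ J X ∨ P' X = eJ J X := by rcases hXp with ⟨h, _⟩ | ⟨_, h⟩; exacts [Or.inl h, Or.inr h]
    have hēX : P X = ēJ J X ∨ P' X = ēJ J X := by rcases hXp with ⟨_, h⟩ | ⟨h, _⟩; exacts [Or.inr h, Or.inl h]
    have hDē : P (Dg J X) = ēJ J X ∨ P' (Dg J X) = ēJ J X := (hdom X hXF _ hēX).2.1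
    have h1 : θ X / (1 - θ X) * (θ J / (1 - θ J)) * (θ (Dg J X) / (1 - θ (Dg J X))) ≤
        O X (eJ J X) * O J (sJ J X) * O (Dg J X) (ēJ J X) :=
      h3le _ _ _ _ _ _ (ht0 _) (ht0 _) (ht0 _) (hOt _ _ heX) (hOt _ _ hJs) (hOt _ _ hDē)
    simp only [hwself]
    by_cases hc : (fun J X => ((P X = P I₀ ∨ P' X = P I₀) ∧ I₀ ∈ F ∧ P' I₀ = r)) J X ∧ Dg J X ≠ I₀
    · rw [if_pos hc]
      have hc' : (((P X = P I₀ ∨ P' X = P I₀) ∧ I₀ ∈ F ∧ P' I₀ = r) ∧ dom X (if (P X = P J ∨ P X = P' J) then P' X else P X) ≠ I₀) := hc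
      rw [if_pos hc']
      have h2 : θ X / (1 - θ X) * (θ J / (1 - θ J)) * (θ I₀ / (1 - θ I₀)) ≤ O X (ēJ J X) * O J (sJ J X) * O I₀ (P I₀) :=
        h3le _ _ _ _ _ _ (ht0 _) (ht0 _) (ht0 _) (hOt _ _ hēX) (hOt _ _ hJs) (hOt _ _ (Or.inl rfl))
      exact add_le_add h1 h2
    · rw [if_neg hc]
      have hc' : ¬ (((P X = P I₀ ∨ P' X = P I₀) ∧ I₀ ∈ F ∧ P' I₀ = r) ∧ dom X (if (P X = P J ∨ P X = P' J) then P' X else P X) ≠ I₀) := hc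
      rw [if_neg hc']
      linarith
  have hwcross' : ∀ J ∈ Js, ∀ X ∈ 𝒳 J, ∀ Y ∈ 𝒳 J, Y ≠ X → ¬ (fun J X Y => (X ≠ Y ∧ (if (P X = P J ∨ P X = P' J) then P' X
        else P X) = (if (P Y = P J ∨ P Y = P' J) then P' Y else P Y))) J X Y →
      θ X / (1 - θ X) * (θ Y / (1 - θ Y)) * (θ J / (1 - θ J)) ≤ wcross J X Y := by
    intro J hJ X hX Y hY _ _
    obtain ⟨-, -, -, -, -, hXp, -, -, hJs, -, -⟩ := hXfacts J hJ X hX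
    obtain ⟨-, -, -, -, -, hYp, -⟩ := hXfacts J hJ Y hY
    have heX : P X = eJ J X ∨ P' X = eJ J X := by rcases hXp with ⟨h, _⟩ | ⟨_, h⟩; exacts [Or.inl h, Or.inr h]
    have hēY : P Y = ēJ J Y ∨ P' Y = ēJ J Y := by rcases hYp with ⟨_, h⟩ | ⟨h, _⟩; exacts [Or.inr h, Or.inl h]
    simp only [hwcross]
    exact h3le _ _ _ _ _ _ (ht0 _) (ht0 _) (ht0 _) (hOt _ _ heX) (hOt _ _ hēY) (hOt _ _ hJs)
  have hHcHh' : Disjoint Hc Hh := by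
    rw [disjoint_left]; intro X hXc hXh
    obtain ⟨u, hu, rfl⟩ := mem_image.1 hXc
    obtain ⟨v, hv, hvu⟩ := mem_image.1 hXh
    obtain ⟨-, -, -, -, -, -, -, hcold, -⟩ := hUc u hu
    obtain ⟨-, -, -, -, -, -, hhot, -⟩ := hUh v hv
    rw [hvu] at hhot
    exact hcold hhot
  have hHc' : ∀ X ∈ Hc, X ∉ Pool ∧ X ≠ I₀ := by
    intro X hX
    obtain ⟨hXF, hXr, -, hIF, -⟩ := hIhub X (mem_union_left _ hX)
    exact ⟨hnotpool _ hXr, fun h => hXF (h ▸ hIF)⟩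
  have hHh' : ∀ X ∈ Hh, X ∉ Pool ∧ X ≠ I₀ := by
    intro X hX
    obtain ⟨hXF, hXr, -, hIF, -⟩ := hIhub X (mem_union_right _ hX)
    exact ⟨hnotpool _ hXr, fun h => hXF (h ▸ hIF)⟩
  have hDh' : ∀ X ∈ Hh, Dh X ∉ Pool ∧ Dh X ≠ I₀ ∧ Dh X ∉ Hh ∧ Dh X ≠ X ∧ θ X ≤ θ (Dh X) ∧ θ X ≤ θ I₀ := by
    intro X hX
    obtain ⟨hXF, hXr, hXq, hIF, hIr, hDr⟩ := hIhub X (mem_union_right _ hX)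
    obtain ⟨hDF, -, -, -, -, hθD⟩ := huI_spec X hXF hXq
    obtain ⟨u, hu, rfl⟩ := mem_image.1 hX
    obtain ⟨-, -, -, -, -, -, hhot, -⟩ := hUh u hu
    refine ⟨hnotpool _ hDr, fun h => hDr.2 (h ▸ hIr), fun h => ?_, fun h => hXF (h ▸ hDF), hθD, ?_⟩
    · obtain ⟨hDF', -⟩ := hIhub (Dh u.2) (mem_union_right _ h)
      exact hDF' hDF
    · have := (hdom u.2 hXF (P I₀) hXq).2.2.2
      rwa [hhot] at this
  have hfib' : ∀ δ ∈ Hh.image Dh, ((Hh.filter (fun X => Dh X = δ))).card ≤ 2 := by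
    intro δ _
    -- the hubs with dominator `δ` are determined by their far port, a port of `δ`
    have hinjOn : Set.InjOn aI ↑(Hh.filter (fun X => Dh X = δ)) := by
      intro X hX Y hY hXY
      obtain ⟨hX, -⟩ := mem_filter.1 (mem_coe.1 hX)
      obtain ⟨hY, -⟩ := mem_filter.1 (mem_coe.1 hY)
      obtain ⟨-, -, hXq, -⟩ := hIhub X (mem_union_right _ hX)
      obtain ⟨-, -, hYq, -⟩ := hIhub Y (mem_union_right _ hY)
      obtain ⟨-, haq, hXp⟩ := haI_spec X hXq
      obtain ⟨-, -, hYp⟩ := haI_spec Y hYq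
      apply hinj; simp only
      rcases hXp with ⟨h1, h2⟩ | ⟨h1, h2⟩ <;> rcases hYp with ⟨h3, h4⟩ | ⟨h3, h4⟩
      · rw [h1, h2, h3, h4, hXY]
      · rw [h1, h2, h3, h4, hXY]; exact Sym2.eq_swap
      · rw [h1, h2, h3, h4, hXY]; exact Sym2.eq_swap
      · rw [h1, h2, h3, h4, hXY]
    have hsub : (Hh.filter (fun X => Dh X = δ)).image aI ⊆ ({P δ, P' δ} : Finset V) := by
      intro a ha
      obtain ⟨X, hX, rfl⟩ := mem_image.1 ha
      obtain ⟨hXh, hXδ⟩ := mem_filter.1 hX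
      obtain ⟨hXF, -, hXq, -⟩ := hIhub X (mem_union_right _ hXh)
      obtain ⟨-, hDa, -⟩ := huI_spec X hXF hXq
      rw [hXδ] at hDa
      rcases hDa with h | h; exacts [mem_insert.2 (Or.inl h.symm), mem_insert_of_mem (mem_singleton.2 h.symm)]
    rw [← card_image_of_injOn hinjOn]
    exact (card_le_card hsub).trans (card_le_two)
  have hwselfIc' : ∀ X ∈ Hc, θ I₀ / (1 - θ I₀) * (θ X / (1 - θ X)) * (θ X / (1 - θ X)) ≤ wselfI X := by
    intro X hX
    obtain ⟨hXF, -, hXq, -⟩ := hIhub X (mem_union_left _ hX)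
    obtain ⟨haX, -, -⟩ := haI_spec X hXq
    obtain ⟨-, -, hDu, -, -, hθD⟩ := huI_spec X hXF hXq
    simp only [hwselfI]
    have h := h3le _ _ _ _ _ _ (ht0 X) (ht0 I₀) (ht0 X) (hOt X _ haX) (hOt I₀ _ (Or.inl rfl))
      ((htmono _ _ hθD).trans (hOt _ _ hDu))
    linarith
  have hwselfIh' : ∀ X ∈ Hh, θ I₀ / (1 - θ I₀) * (θ X / (1 - θ X)) * (θ (Dh X) / (1 - θ (Dh X))) ≤ wselfI X := by
    intro X hX
    obtain ⟨hXF, -, hXq, -⟩ := hIhub X (mem_union_right _ hX)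
    obtain ⟨haX, -, -⟩ := haI_spec X hXq
    obtain ⟨-, -, hDu, -, -, -⟩ := huI_spec X hXF hXq
    simp only [hwselfI]
    have h := h3le _ _ _ _ _ _ (ht0 X) (ht0 I₀) (ht0 (Dh X)) (hOt X _ haX) (hOt I₀ _ (Or.inl rfl)) (hOt _ _ hDu)
    linarith
  have hwcrossI' : ∀ X ∈ Hc ∪ Hh, ∀ Y ∈ Hc ∪ Hh, X < Y →
      θ I₀ / (1 - θ I₀) * (θ X / (1 - θ X)) * (θ Y / (1 - θ Y)) ≤ wcrossI X Y := by
    intro X hX Y hY _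
    obtain ⟨-, -, hXq, -⟩ := hIhub X hX
    obtain ⟨-, -, hYq, -⟩ := hIhub Y hY
    obtain ⟨haX, -, -⟩ := haI_spec X hXq
    obtain ⟨haY, -, -⟩ := haI_spec Y hYq
    simp only [hwcrossI]
    have h := h3le _ _ _ _ _ _ (ht0 X) (ht0 Y) (ht0 I₀) (hOt X _ haX) (hOt Y _ haY) (hOt I₀ _ (Or.inl rfl))
    linarith
  have hUg' : ∀ u ∈ Ug, Jf u ∈ Js ∧ u.2 ∈ 𝒳 (Jf u) ∧ u.2 ∈ u.1 ∧ Jf u ∈ u.1 ∧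
      ∀ K ∈ u.1, K ≠ u.2 → K ≠ Jf u → (K ∈ Pool ∨ ((fun J X => ((P X = P I₀ ∨ P' X = P I₀) ∧ I₀ ∈ F ∧ P' I₀ = r)) (Jf u) u.2 ∧ K = I₀)) := by
    intro u hu
    obtain ⟨hXS, -, hXr, hJS, -, -, -, -, -, -, -, -, hrid, hadj⟩ := hUg u hu
    refine ⟨mem_image_of_mem Jf hu, mem_image.2 ⟨u, mem_filter.2 ⟨hu, rfl⟩, rfl⟩, hXS, hJS, fun K hK hKX hKJ => ?_⟩
    by_cases hKI : K = I₀
    · right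
      subst hKI
      have hKr := hrid K hK hKX hKJ
      -- `I₀` is a rider containing `r`: it is the leaf class and `X` passes through `P I₀`
      have hIF : K ∈ F := by
        by_contra hKF
        exact hI₀pool (Or.inl ⟨hKF, hKr⟩)
      have hIr : P' K = r := by rcases hKr with h | h; exacts [absurd (Or.inr ⟨hIF, h⟩) hI₀pool, h]
      refine ⟨⟨?_, hIF, hIr⟩, rfl⟩
      rcases hadj K hK with h | h | h | h
      · exact Or.inl h.symm
      · exact Or.inr h.symm
      · exact absurd h.symm (by rw [hIr]; exact hXr.1)
      · exact absurd h.symm (by rw [hIr]; exact hXr.2)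
    · exact Or.inl (hpool_of_r K hKI (hrid K hK hKX hKJ))
  have hUc' : ∀ u ∈ Uc, u.2 ∈ Hc ∧ u.2 ∈ u.1 ∧ I₀ ∈ u.1 ∧ ∀ K ∈ u.1, K ≠ u.2 → K ≠ I₀ → K ∈ Pool := by
    intro u hu
    obtain ⟨hXS, -, -, -, hIS, -, -, -, -, hrid⟩ := hUc u hu
    exact ⟨mem_image_of_mem _ hu, hXS, hIS, fun K hK hKX hKI => hpool_of_r K hKI (hrid K hK hKX hKI)⟩
  have hUh'' : ∀ u ∈ Uh, u.2 ∈ Hh ∧ u.2 ∈ u.1 ∧ (I₀ ∈ u.1 ∨ Dh u.2 ∈ u.1) ∧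
      ∀ K ∈ u.1, K ≠ u.2 → K ≠ I₀ → K ≠ Dh u.2 → K ∈ Pool := by
    intro u hu
    obtain ⟨hXS, -, -, -, -, -, -, -, hor, hrid⟩ := hUh u hu
    exact ⟨mem_image_of_mem _ hu, hXS, hor, fun K hK hKX hKI hKD => hpool_of_r K hKI (hrid K hK hKX hKI hKD)⟩
  have key := pool_bound θ hθ0 hθ1 Pool I₀ hI₀P Js hJs' (fun J X => ((P X = P I₀ ∨ P' X = P I₀) ∧ I₀ ∈ F ∧ P' I₀ = r)) 𝒳 h𝒳' (fun J X Y => (X ≠ Y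
        ∧ (if (P X = P J ∨ P X = P' J) then P' X else P X) = (if (P Y = P J ∨ P Y = P' J) then P' Y else P Y))) hMsymm' hMuniq' Dg hDg' wself hwself'
    wcross hwcross' Hc Hh hHcHh' hHc' hHh' Dh hDh' hfib' wselfI hwselfIc' hwselfIh' wcrossI hwcrossI' Ug Uc Uh Jf hUg' hUc' hUh''
  simpa only [hwself, hwcross, hwselfI, hwcrossI, heJ, hēJ, hsJ, haI, hDh, huI, hDg, h𝒳, hJs, hHc, hHh, hPool, hpool] using key

end StarSet

end Summit.CriticalPhenomena.PercolationContinuityZ3.Theorems
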